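import Mathlib
import Summits.Ventures.PercRepro2.HCov
import Summits.Ventures.PercRepro2.EdgeCubic
import Summits.Ventures.PercRepro2.PendantA3Pins
import Summits.Ventures.PercRepro2.PendantA3Masses
import Summits.Ventures.PercRepro2.PendantBSideBound
import Summits.Ventures.PercRepro2.PendantA3AtU

/-!
# The middle coefficient of the last pendant in one-copy masses, and its closure modulo the
restricted cross covariance `(V4)` (blind cell PercRepro2, mine-2 g56, 2026-08-30;
`conjectures/MINE-2.md` M2-123 / M2-124)

Let `a₃` be a leaf at `u` (edge `f`), `Q = {a₁ ↮ a₂}`, `T = {u ∈ C(a₂)} ∩ Q`, `T′ = {u ∈ C(a₁)} ∩ Q`,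
`PD = {u ∉ C(a₁) ∪ C(a₂)} ∩ Q`, `lv = {v ∈ C(a₁)}`, `hv = {v ∈ C(a₂)}`, `P = P(Q)`.  The middle
Bernstein coefficient `W = B1 − Gc p[f↦0]` of the pendant (`PendantA3AtU.lean`) is the ONE-COPY
cubic of the base graph with the five marks `(a₁, a₂, o, b, u)` (**`W_eq`**):

  `W = 2·(V4 + P(PD)·Cr_bo) + 2·(V4′ + P(PD)·Cr_ob)`,

`Cr_bo = P(Q,lb)P(Q,ho) − P·P(Q,ho,lb) ≥ 0`, `Cr_ob` its mirror (BHK06 Thm 1.4), and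

  `V4 = P²·P(Q, u∈C₂, b∈C₁, o∈U) − P·P(Q,lb)·P(Q, u∈C₂, o∈U) + P(Q, o∈U)·[P(Q,lb)P(T) − P·P(T,lb)] + P·Cr_bo`

(i.e. `P³·[Cov_Q(1_{b∈C₁}, 1_{u∈C₂}1_{o∈U}) + P_Q(o∈U)·Cr(b,u) + Cr(b,o)]`), `V4′` its mirror.
**`W_nonneg_of_V4`**: `0 ≤ V4` and `0 ≤ V4′` give `0 ≤ W`; **`HCov_pendant_of_V4`**: with (HCOV) on
the merged instance `a₃ := u`, (HCOV) at the pendant.  `(V4)` and its mirror are candidates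
(0 negatives in 720 exact-rechecked climbs each; the finer splits are false — M2-123).
Own work; standard axioms.
-/

namespace Summit.Ventures.PercRepro2

namespace PendantA3

open CovForm CovForm.EdgeLine CovForm.SideBound

section Split

variable {V : Type*} {E : Type*} [Fintype E] [DecidableEq E] [DecidableEq V] {R : Type*} [Field R]
  [LinearOrder R] [IsStrictOrderedRing R]

omit [LinearOrder R] [IsStrictOrderedRing R] in
/-- `P(PD ∩ X) = P(Q ∩ X) − P(T ∩ X) − P(T′ ∩ X)` (from `Qsplit`). -/
lemma prob_PD_inter_eq (p : E → R) (ends : E → Sym2 V) (a₁ a₂ u : V) (X : Set (Config E)) :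
    prob p (PDEvent ends a₁ a₂ u ∩ X) =
      prob p (avoidAll ends a₂ {a₁} ∩ X) - prob p (TEvent ends a₁ a₂ u ∩ X) -
        prob p (TEvent ends a₂ a₁ u ∩ X) := by
  have h := Qsplit p ends a₁ a₂ u X
  rw [h]
  ring

omit [LinearOrder R] [IsStrictOrderedRing R] in
/-- `P(PD) = P(Q) − P(T) − P(T′)`. -/
lemma prob_PD_eq (p : E → R) (ends : E → Sym2 V) (a₁ a₂ u : V) :
    prob p (PDEvent ends a₁ a₂ u) =
      prob p (avoidAll ends a₂ {a₁}) - prob p (TEvent ends a₁ a₂ u) -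
        prob p (TEvent ends a₂ a₁ u) := by
  have h := Qsplit_univ p ends a₁ a₂ u
  rw [h]
  ring

end Split

section Main

variable {V : Type*} {E : Type*} [Fintype E] [DecidableEq E] [Fintype V] [DecidableEq V]
  {R : Type*} [Field R] [LinearOrder R] [IsStrictOrderedRing R]

omit [Fintype V] in
/-- **The middle coefficient of the last pendant in one-copy masses**:
`B1 − Gc p[f↦0] = 2·(V4 + P(PD)·Cr_bo) + 2·(V4′ + P(PD)·Cr_ob)` (see the module docstring). -/
theorem W_eq (p : E → R) {ends : E → Sym2 V} {f : E} {o a₁ a₂ a₃ b u : V}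
    (hf : ends f = s(a₃, u)) (hleaf : ∀ e, a₃ ∈ ends e → e = f) (h3u : a₃ ≠ u) (h13 : a₁ ≠ a₃)
    (h23 : a₂ ≠ a₃) (ho3 : o ≠ a₃) (hb3 : b ≠ a₃) :
    B1 p ends o a₁ a₂ a₃ b f - Gc (Function.update p f 0) ends o a₁ a₂ a₃ b =
      2 * ((prob p (avoidAll ends a₂ {a₁}) ^ 2 *
            (prob p (TEvent ends a₁ a₂ u ∩ (connEvent ends a₁ o ∩ connEvent ends a₁ b)) +
              prob p (TEvent ends a₁ a₂ u ∩ (connEvent ends a₂ o ∩ connEvent ends a₁ b))) -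
          prob p (avoidAll ends a₂ {a₁}) * prob p (avoidAll ends a₂ {a₁} ∩ connEvent ends a₁ b) *
            (prob p (TEvent ends a₁ a₂ u ∩ connEvent ends a₁ o) +
              prob p (TEvent ends a₁ a₂ u ∩ connEvent ends a₂ o)) +
          (prob p (avoidAll ends a₂ {a₁} ∩ connEvent ends a₁ o) +
              prob p (avoidAll ends a₂ {a₁} ∩ connEvent ends a₂ o)) *
            (prob p (avoidAll ends a₂ {a₁} ∩ connEvent ends a₁ b) * prob p (TEvent ends a₁ a₂ u) -
              prob p (avoidAll ends a₂ {a₁}) * prob p (TEvent ends a₁ a₂ u ∩ connEvent ends a₁ b)) +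
          prob p (avoidAll ends a₂ {a₁}) *
            (prob p (avoidAll ends a₂ {a₁} ∩ connEvent ends a₁ b) *
                prob p (avoidAll ends a₂ {a₁} ∩ connEvent ends a₂ o) -
              prob p (avoidAll ends a₂ {a₁}) *
                prob p (avoidAll ends a₂ {a₁} ∩ (connEvent ends a₂ o ∩ connEvent ends a₁ b)))) +
          prob p (PDEvent ends a₁ a₂ u) *
            (prob p (avoidAll ends a₂ {a₁} ∩ connEvent ends a₁ b) *
                prob p (avoidAll ends a₂ {a₁} ∩ connEvent ends a₂ o) -
              prob p (avoidAll ends a₂ {a₁}) *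
                prob p (avoidAll ends a₂ {a₁} ∩ (connEvent ends a₂ o ∩ connEvent ends a₁ b)))) +
      2 * ((prob p (avoidAll ends a₂ {a₁}) ^ 2 *
            (prob p (TEvent ends a₂ a₁ u ∩ (connEvent ends a₁ o ∩ connEvent ends a₂ b)) +
              prob p (TEvent ends a₂ a₁ u ∩ (connEvent ends a₂ o ∩ connEvent ends a₂ b))) -
          prob p (avoidAll ends a₂ {a₁}) * prob p (avoidAll ends a₂ {a₁} ∩ connEvent ends a₂ b) *
            (prob p (TEvent ends a₂ a₁ u ∩ connEvent ends a₁ o) +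
              prob p (TEvent ends a₂ a₁ u ∩ connEvent ends a₂ o)) +
          (prob p (avoidAll ends a₂ {a₁} ∩ connEvent ends a₁ o) +
              prob p (avoidAll ends a₂ {a₁} ∩ connEvent ends a₂ o)) *
            (prob p (avoidAll ends a₂ {a₁} ∩ connEvent ends a₂ b) * prob p (TEvent ends a₂ a₁ u) -
              prob p (avoidAll ends a₂ {a₁}) * prob p (TEvent ends a₂ a₁ u ∩ connEvent ends a₂ b)) +
          prob p (avoidAll ends a₂ {a₁}) *
            (prob p (avoidAll ends a₂ {a₁} ∩ connEvent ends a₂ b) *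
                prob p (avoidAll ends a₂ {a₁} ∩ connEvent ends a₁ o) -
              prob p (avoidAll ends a₂ {a₁}) *
                prob p (avoidAll ends a₂ {a₁} ∩ (connEvent ends a₁ o ∩ connEvent ends a₂ b)))) +
          prob p (PDEvent ends a₁ a₂ u) *
            (prob p (avoidAll ends a₂ {a₁} ∩ connEvent ends a₂ b) *
                prob p (avoidAll ends a₂ {a₁} ∩ connEvent ends a₁ o) -
              prob p (avoidAll ends a₂ {a₁}) *
                prob p (avoidAll ends a₂ {a₁} ∩ (connEvent ends a₁ o ∩ connEvent ends a₂ b)))) := by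
  obtain ⟨hQ0, hD0, hDo0, hEQbo0, hEQb30, hEQb3o0, hEQo0, hEQ30, hEQ3o0, hPDb0, hPDbo0, hgap0⟩ :=
    pins_zero_pendant p hf hleaf h3u h13 h23 ho3 hb3
  obtain ⟨hQ1, hD1, hDo1, hEQbo1, hEQb31, hEQb3o1, hEQo1, hEQ31, hEQ3o1, hPDb1, hPDbo1, hgap1⟩ :=
    pins_one_pendant p hf hleaf h3u h13 h23 ho3 hb3
  unfold B1
  rw [Gc_eq_GcPoly, hQ0, hD0, hDo0, hEQbo0, hEQb30, hEQb3o0, hEQo0, hEQ30, hEQ3o0,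
    hPDb0, hPDbo0, hgap0, hQ1, hD1, hDo1, hEQbo1, hEQb31, hEQb3o1, hEQo1, hEQ31, hEQ3o1, hPDb1,
    hPDbo1, hgap1]
  unfold B1Poly GcPoly polar1 EQbo EQb3 EQb3o EQo EQ3 EQ3o PDb PDbo Do
  rw [gap_eq_Q]
  simp only [prob_PD_inter_eq p ends a₁ a₂ u, prob_PD_eq p ends a₁ a₂ u]
  ring

/-- **`W ≥ 0` from the two restricted cross covariances**: `0 ≤ V4`, `0 ≤ V4′` (the two
bracketed cubics of `W_eq`) give `0 ≤ B1 − Gc p[f↦0]`. -/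
theorem W_nonneg_of_V4 (p : E → R) (hp : IsProbVec p) {ends : E → Sym2 V} {f : E}
    {o a₁ a₂ a₃ b u : V} (hf : ends f = s(a₃, u)) (hleaf : ∀ e, a₃ ∈ ends e → e = f)
    (h3u : a₃ ≠ u) (h13 : a₁ ≠ a₃) (h23 : a₂ ≠ a₃) (ho3 : o ≠ a₃) (hb3 : b ≠ a₃)
    (hV4 : 0 ≤ prob p (avoidAll ends a₂ {a₁}) ^ 2 *
            (prob p (TEvent ends a₁ a₂ u ∩ (connEvent ends a₁ o ∩ connEvent ends a₁ b)) +
              prob p (TEvent ends a₁ a₂ u ∩ (connEvent ends a₂ o ∩ connEvent ends a₁ b))) -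
          prob p (avoidAll ends a₂ {a₁}) * prob p (avoidAll ends a₂ {a₁} ∩ connEvent ends a₁ b) *
            (prob p (TEvent ends a₁ a₂ u ∩ connEvent ends a₁ o) +
              prob p (TEvent ends a₁ a₂ u ∩ connEvent ends a₂ o)) +
          (prob p (avoidAll ends a₂ {a₁} ∩ connEvent ends a₁ o) +
              prob p (avoidAll ends a₂ {a₁} ∩ connEvent ends a₂ o)) *
            (prob p (avoidAll ends a₂ {a₁} ∩ connEvent ends a₁ b) * prob p (TEvent ends a₁ a₂ u) -
              prob p (avoidAll ends a₂ {a₁}) * prob p (TEvent ends a₁ a₂ u ∩ connEvent ends a₁ b)) +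
          prob p (avoidAll ends a₂ {a₁}) *
            (prob p (avoidAll ends a₂ {a₁} ∩ connEvent ends a₁ b) *
                prob p (avoidAll ends a₂ {a₁} ∩ connEvent ends a₂ o) -
              prob p (avoidAll ends a₂ {a₁}) *
                prob p (avoidAll ends a₂ {a₁} ∩ (connEvent ends a₂ o ∩ connEvent ends a₁ b))))
    (hV4' : 0 ≤ prob p (avoidAll ends a₂ {a₁}) ^ 2 *
            (prob p (TEvent ends a₂ a₁ u ∩ (connEvent ends a₁ o ∩ connEvent ends a₂ b)) +
              prob p (TEvent ends a₂ a₁ u ∩ (connEvent ends a₂ o ∩ connEvent ends a₂ b))) -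
          prob p (avoidAll ends a₂ {a₁}) * prob p (avoidAll ends a₂ {a₁} ∩ connEvent ends a₂ b) *
            (prob p (TEvent ends a₂ a₁ u ∩ connEvent ends a₁ o) +
              prob p (TEvent ends a₂ a₁ u ∩ connEvent ends a₂ o)) +
          (prob p (avoidAll ends a₂ {a₁} ∩ connEvent ends a₁ o) +
              prob p (avoidAll ends a₂ {a₁} ∩ connEvent ends a₂ o)) *
            (prob p (avoidAll ends a₂ {a₁} ∩ connEvent ends a₂ b) * prob p (TEvent ends a₂ a₁ u) -
              prob p (avoidAll ends a₂ {a₁}) * prob p (TEvent ends a₂ a₁ u ∩ connEvent ends a₂ b)) +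
          prob p (avoidAll ends a₂ {a₁}) *
            (prob p (avoidAll ends a₂ {a₁} ∩ connEvent ends a₂ b) *
                prob p (avoidAll ends a₂ {a₁} ∩ connEvent ends a₁ o) -
              prob p (avoidAll ends a₂ {a₁}) *
                prob p (avoidAll ends a₂ {a₁} ∩ (connEvent ends a₁ o ∩ connEvent ends a₂ b)))) :
    0 ≤ B1 p ends o a₁ a₂ a₃ b f - Gc (Function.update p f 0) ends o a₁ a₂ a₃ b := by
  rw [W_eq p hf hleaf h3u h13 h23 ho3 hb3]
  have hPD := prob_nonneg hp (PDEvent ends a₁ a₂ u)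
  have h1 := cross_whole_mirror p hp ends o a₁ a₂ b
  have h2 := cross_whole p hp ends o a₁ a₂ b
  have c1 : 0 ≤ prob p (avoidAll ends a₂ {a₁} ∩ connEvent ends a₁ b) *
      prob p (avoidAll ends a₂ {a₁} ∩ connEvent ends a₂ o) -
      prob p (avoidAll ends a₂ {a₁}) *
        prob p (avoidAll ends a₂ {a₁} ∩ (connEvent ends a₂ o ∩ connEvent ends a₁ b)) := by
    nlinarith [h1]
  have c2 : 0 ≤ prob p (avoidAll ends a₂ {a₁} ∩ connEvent ends a₂ b) *
      prob p (avoidAll ends a₂ {a₁} ∩ connEvent ends a₁ o) -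
      prob p (avoidAll ends a₂ {a₁}) *
        prob p (avoidAll ends a₂ {a₁} ∩ (connEvent ends a₁ o ∩ connEvent ends a₂ b)) := by
    nlinarith [h2]
  have t1 := mul_nonneg hPD c1
  have t2 := mul_nonneg hPD c2
  linarith

/-- **The last pendant modulo `(V4)` and its mirror**: (HCOV) on the merged instance `a₃ := u`
together with the two restricted cross-covariance inequalities give (HCOV) at the pendant. -/
theorem HCov_pendant_of_V4 (p : E → R) (hp : IsProbVec p) {ends : E → Sym2 V} {f : E}
    {o a₁ a₂ a₃ b u : V} (hf : ends f = s(a₃, u)) (hleaf : ∀ e, a₃ ∈ ends e → e = f)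
    (h3u : a₃ ≠ u) (h13 : a₁ ≠ a₃) (h23 : a₂ ≠ a₃) (ho3 : o ≠ a₃) (hb3 : b ≠ a₃)
    (h₁ : HCov p ends o a₁ a₂ u b)
    (hV4 : 0 ≤ prob p (avoidAll ends a₂ {a₁}) ^ 2 *
            (prob p (TEvent ends a₁ a₂ u ∩ (connEvent ends a₁ o ∩ connEvent ends a₁ b)) +
              prob p (TEvent ends a₁ a₂ u ∩ (connEvent ends a₂ o ∩ connEvent ends a₁ b))) -
          prob p (avoidAll ends a₂ {a₁}) * prob p (avoidAll ends a₂ {a₁} ∩ connEvent ends a₁ b) *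
            (prob p (TEvent ends a₁ a₂ u ∩ connEvent ends a₁ o) +
              prob p (TEvent ends a₁ a₂ u ∩ connEvent ends a₂ o)) +
          (prob p (avoidAll ends a₂ {a₁} ∩ connEvent ends a₁ o) +
              prob p (avoidAll ends a₂ {a₁} ∩ connEvent ends a₂ o)) *
            (prob p (avoidAll ends a₂ {a₁} ∩ connEvent ends a₁ b) * prob p (TEvent ends a₁ a₂ u) -
              prob p (avoidAll ends a₂ {a₁}) * prob p (TEvent ends a₁ a₂ u ∩ connEvent ends a₁ b)) +
          prob p (avoidAll ends a₂ {a₁}) *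
            (prob p (avoidAll ends a₂ {a₁} ∩ connEvent ends a₁ b) *
                prob p (avoidAll ends a₂ {a₁} ∩ connEvent ends a₂ o) -
              prob p (avoidAll ends a₂ {a₁}) *
                prob p (avoidAll ends a₂ {a₁} ∩ (connEvent ends a₂ o ∩ connEvent ends a₁ b))))
    (hV4' : 0 ≤ prob p (avoidAll ends a₂ {a₁}) ^ 2 *
            (prob p (TEvent ends a₂ a₁ u ∩ (connEvent ends a₁ o ∩ connEvent ends a₂ b)) +
              prob p (TEvent ends a₂ a₁ u ∩ (connEvent ends a₂ o ∩ connEvent ends a₂ b))) -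
          prob p (avoidAll ends a₂ {a₁}) * prob p (avoidAll ends a₂ {a₁} ∩ connEvent ends a₂ b) *
            (prob p (TEvent ends a₂ a₁ u ∩ connEvent ends a₁ o) +
              prob p (TEvent ends a₂ a₁ u ∩ connEvent ends a₂ o)) +
          (prob p (avoidAll ends a₂ {a₁} ∩ connEvent ends a₁ o) +
              prob p (avoidAll ends a₂ {a₁} ∩ connEvent ends a₂ o)) *
            (prob p (avoidAll ends a₂ {a₁} ∩ connEvent ends a₂ b) * prob p (TEvent ends a₂ a₁ u) -
              prob p (avoidAll ends a₂ {a₁}) * prob p (TEvent ends a₂ a₁ u ∩ connEvent ends a₂ b)) +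
          prob p (avoidAll ends a₂ {a₁}) *
            (prob p (avoidAll ends a₂ {a₁} ∩ connEvent ends a₂ b) *
                prob p (avoidAll ends a₂ {a₁} ∩ connEvent ends a₁ o) -
              prob p (avoidAll ends a₂ {a₁}) *
                prob p (avoidAll ends a₂ {a₁} ∩ (connEvent ends a₁ o ∩ connEvent ends a₂ b)))) :
    HCov p ends o a₁ a₂ a₃ b :=
  HCov_pendant_of_W p hp hf hleaf h3u h13 h23 ho3 hb3 h₁
    (W_nonneg_of_V4 p hp hf hleaf h3u h13 h23 ho3 hb3 hV4 hV4')

end Main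

end PendantA3

end Summit.Ventures.PercRepro2
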